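import Summits.ABC.IUTFork.Cor312ThetaSideContentM
import Summits.ABC.IUTFork.Cor312ThetaSideOrbitHullM
import Summits.ABC.IUTFork.Cor312ThetaSideGenuineM
import Summits.ABC.IUTFork.Cor312PilotIdelesMReadRat
import HarnessLib

/-!
# [IUTchIII] Corollary 3.12 at the M-LEVEL sharp setting of the datum's OWN Θ-ideles — the READ binder `hΘ` of branch C
# DISCHARGED: `−|log(Θ)|(setting) ≤ −|log(Θ)|(genuine input)` with NO residual hypothesis (G1-Θ closer, both routes)

PROOF-ONLY record file (D-0012; no definitions) of the abc-iut cell (R2 S-chain team, seat abc-iut-s2-p8; branch C «abc ⇐ S», C-lead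
ruling C-R12 (e) «target #2′: the M-level (V̲, K_{v̲}) real volume setting»). TAKES NO SIDE on [IUTchIII] Cor. 3.12.

The composition of the G1-Θ units, nothing new: abc-iut-w5-d166's assembly `negLogTheta_settingMSharp_le_genuine_of_orbitHull (hA)`
(`Cor312ThetaSideGenuineM`, p438889: hΘ at the frames-route sharp setting `settingMSharp` of the datum's own ideles `tOfIdeleData D r`
modulo the per-packet orbit-hull bound (hA); (h∞)/(hlow) from abc-iut-s2-p9's P5 files), this seat's P6-instA
`thetaLocal_settingMSharp_le_coe_sum_content` (`Cor312ThetaSideContentM`, p439950: the local Θ-volume ≤ the content-hull sum for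
ANY capsule-symmetric content family, via abc-iut-s2-p7's generic p437184 and the summand-route `settingPrVolSharpM`, p438078), and
abc-iut-s2-p7's P6-instB (`Cor312ThetaSideOrbitHullM`, p439554: a symmetric content family of the slot unions EXISTS,
`exists_symm_slotContentFamily_tThetaM`, and its content-hull sum IS the orbit sum, `sum_weightM_content_eq_orbitSumM`), with
abc-iut-w5-d033's unit-off-`V^bad_mod` side condition `norm_tThetaM_eq_one_of_not_mem_image` (p438311):

* `thetaLocal_settingMSharp_tOfIdeleData_le_orbitSumM` — (hA) PROVED: at every label `j = i+1` and finite rational place `u`,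
  the local Θ-volume of `settingMSharp … (tOfIdeleData D r) …` is at most `orbitSumM D r i u`;
* **`negLogTheta_settingMSharp_tOfIdeleData_le_genuine`**: `(settingMSharp … (tOfIdeleData D r) tq htq0 Sq htq1).negLogTheta ≤
  ↑(ThetaData.volumeInputOf D r).negLogTheta` — the READ binder `hΘ` of `Conditional/AbcOfS*.lean` at the M-level setting of the
  datum's own Θ-ideles, UNCONDITIONAL in the Θ-ideles (the `q`-ideles `tq` stay binders with `htq0`/`htq1`, discharged for the datum's
  own `tqM` by abc-iut-w5-d033 likewise); the summand-route twin `negLogTheta_settingPrVolSharpM_tOfIdeleData_le_genuine`; and the form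
  for a volume input `I` of `D`, `negLogTheta_settingMSharp_le_of_isVolumeInputOf` (`IsVolumeInputOf D I` ⟹ `−|log(Θ)| ≤ ↑I.negLogTheta`).

[cite: Mochizuki2012, IUTchIII Cor. 3.12 p. 173–174; IUTchIV Thm. 1.10 Steps (v)–(viii) p. 27–31] [cite: DupuyHilado2025, §3.6, §4.7,
§4.9, §4.10, §4.12] [claim: Mochizuki2012, status: disputed] for every quoted construction. HONEST FRAMING: an inequality between
OUR typed `−|log(Θ)|` of OUR typed M-level setting and abc-iut-S2's DEFINED number for the same genuine input — the one-sided Θ-side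
identification, `≤` because the typed (Ind2) is the family of tensor products of lattice automorphisms (content hulls bound the frame
hull from above) and the archimedean summand `((l+5)/4)·log π > 0` of the genuine number is not modelled by the trivial archimedean
container; nothing here asserts or denies [IUTchIII] Cor. 3.12 or takes a side on any author; typed ≠ proved; instantiated ≠ endorsed.
-/

noncomputable section

open Set Function NumberField IsDedekindDomain
open scoped Pointwise

namespace Summit.ABC.IUTFork.Thm311.Real

open Cor312 Cor312Vol Literature.IUT.LogThetaLattice Literature.IUT.LogVolume Literature.IUT.HodgeTheaters
  Literature.NumberTheory.NumberFields

variable {F K Fbar : Type} [Field F] [NumberField F] [Field K] [NumberField K] [Algebra F K]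
  [Field Fbar] [Algebra F Fbar] [Algebra K Fbar] {E : WeierstrassCurve F} [E.IsElliptic] {l : ℕ}
  {Pb : BadPlacePredicates K} (D : InitialThetaData F K Fbar E l Pb) {logvK : PadicLogsVal K}
  (hlog : LogvAnalyticVal logvK) (r : ThetaData.IdeleData D)
  (tq : ∀ (u : FinitePlace ℚ) (x : (thetaIndexOfInitial D).Fibre (Val.non u)),
    kOfM D (ratChar u) u (natCast_ratChar_mem u) x)
  (M : Type) [Field M] [NumberField M]
  (archPk : ∀ (j : (thetaIndexOfInitial D).Label) (vQ : (thetaIndexOfInitial D).VQ),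
    Set ((logShellsOfInitialDH D logvK).Packet j vQ))
  (archSub : ∀ (j : (thetaIndexOfInitial D).Label) (v : (thetaIndexOfInitial D).V),
    Set ((logShellsOfInitialDH D logvK).Packet j ((thetaIndexOfInitial D).over v)))
  (Ψ : ℤ → ∀ v : (thetaIndexOfInitial D).V, v ∈ (thetaIndexOfInitial D).Vbad →
    Set ((logShellsOfInitialDH D logvK).StarPacket v))
  (act : ℤ → ∀ v : (thetaIndexOfInitial D).V, v ∈ (thetaIndexOfInitial D).Vbad →
    (logShellsOfInitialDH D logvK).StarPacket v → Module.End ℚ ((logShellsOfInitialDH D logvK).StarPacket v))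
  (Mmod : ℤ → ∀ j : (thetaIndexOfInitial D).LabelStar, Set ((logShellsOfInitialDH D logvK).GlobalPacket j.1))
  (region : ℤ → ∀ j : (thetaIndexOfInitial D).LabelStar, FinDivisor M → ∀ vQ : (thetaIndexOfInitial D).VQ,
    Set ((logShellsOfInitialDH D logvK).Packet j.1 vQ))
  (n : ℤ) {HT : Type} {LogLink : HT → HT → Type} {IsFull : ∀ {s t : HT}, LogLink s t → Prop}
  (lat : LGPGaussianLogThetaLattice LogLink IsFull)
  {Frd : Type} {IsoF : Frd → Frd → Type} {Ob : Frd → Type} {realify : Frd → Frd} {Strip : Type}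
  {IsoS : Strip → Strip → Type}
  {Mv : ∀ v : (thetaIndexOfInitial D).V, v ∈ (thetaIndexOfInitial D).Vbad → Type} [∀ v h, Monoid (Mv v h)]
  (sig : GlobalLGPFrobenioidSignature (thetaIndexOfInitial D).lstar (thetaIndexOfInitial D).V
    (· ∈ (thetaIndexOfInitial D).Vbad) Frd IsoF Ob realify Strip IsoS Mv)
  (split : SplittingMonoids Mv) {ObΔ : Type}
  {N : ∀ v : (thetaIndexOfInitial D).V, v ∈ (thetaIndexOfInitial D).Vbad → Type} [∀ v h, Monoid (N v h)]
  (qData : QPilotData ObΔ N)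
  (htq0 : ∀ u x, tq u x ≠ 0) (Sq : Finset (FinitePlace ℚ))
  (htq1 : ∀ (u : FinitePlace ℚ) (x : (thetaIndexOfInitial D).Fibre (Val.non u)), u ∉ Sq → ‖tq u x‖ = 1)

/-- **(hA) PROVED at the frames-route M-level sharp setting of the datum's own Θ-ideles**: at every label `j = i+1 ∈ 𝔽_l^⋇` and finite
rational place `u`, the local Θ-volume is at most the ORBIT SUM `orbitSumM D r i u` (P6-instA at abc-iut-s2-p7's symmetric content family
of the slot unions, P6-instB; [IUTchIV] Thm. 1.10 Step (v)). [cite: Mochizuki2012, IUTchIV Thm. 1.10 Step (v) p. 27–28] -/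
theorem thetaLocal_settingMSharp_tOfIdeleData_le_orbitSumM (i : Fin (thetaIndexOfInitial D).lstar) (u : FinitePlace ℚ) :
    (settingMSharp D hlog M archPk archSub Ψ act Mmod region n lat sig split qData (tOfIdeleData D r) tq htq0 Sq htq1).thetaLocal
        (Setting.labelSucc i) (Val.non u) ≤ ((orbitSumM D r i u : ℝ) : WithTop ℝ) := by
  letI : Fintype ((thetaIndexOfInitial D).Fibre (Val.non u)) := Fintype.ofFinite _
  obtain ⟨m, hsymm, hm⟩ := exists_symm_slotContentFamily_tThetaM D r i u
  have h := thetaLocal_settingMSharp_le_coe_sum_content D hlog (tOfIdeleData D r) tq M archPk archSub Ψ act Mmod region n lat sig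
    split qData htq0 Sq htq1 (tOfIdeleData_ne_zero D r) _
    (fun u i x hu => norm_tThetaM_eq_one_of_not_mem_image D (ratChar u) u (natCast_ratChar_mem u) r i x hu) i u m hsymm
    (fun e' => (hm e').1)
  exact h.trans (WithTop.coe_le_coe.mpr (le_of_eq (sum_weightM_content_eq_orbitSumM D r i u m hm)))

/-- **hΘ DISCHARGED — `−|log(Θ)|` of the frames-route M-level sharp setting of the datum's OWN Θ-ideles is at most abc-iut-S2's
genuine number**: `(settingMSharp … (tOfIdeleData D r) tq htq0 Sq htq1).negLogTheta ≤ ↑(volumeInputOf D r).negLogTheta`, NO residual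
hypothesis on the Θ-side (abc-iut-w5-d166's `negLogTheta_settingMSharp_le_genuine_of_orbitHull` at (hA) above). The READ binder of
`Conditional/AbcOfS*.lean` at the genuine carriers. [cite: Mochizuki2012, IUTchIII Cor. 3.12 p. 173–174] -/
theorem negLogTheta_settingMSharp_tOfIdeleData_le_genuine :
    (settingMSharp D hlog M archPk archSub Ψ act Mmod region n lat sig split qData (tOfIdeleData D r) tq htq0 Sq htq1).negLogTheta ≤
      (((ThetaData.volumeInputOf D r).negLogTheta : ℝ) : WithTop ℝ) :=
  negLogTheta_settingMSharp_le_genuine_of_orbitHull D hlog r M archPk archSub Ψ act Mmod region n lat sig split qData tq htq0 Sq htq1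
    fun i u => thetaLocal_settingMSharp_tOfIdeleData_le_orbitSumM D hlog r tq M archPk archSub Ψ act Mmod region n lat sig split qData
      htq0 Sq htq1 i u

/-- **… and for the summand-route sharp setting `settingPrVolSharpM`** (p438078) of the datum's own Θ-ideles (same number, abc-iut-w4-d013's
two-routes identity). [cite: Mochizuki2012, IUTchIII Cor. 3.12 p. 173–174] -/
theorem negLogTheta_settingPrVolSharpM_tOfIdeleData_le_genuine :
    (settingPrVolSharpM D hlog (tOfIdeleData D r) tq M archPk archSub Ψ act Mmod region n lat sig split qData htq0 Sq
        htq1).negLogTheta ≤ (((ThetaData.volumeInputOf D r).negLogTheta : ℝ) : WithTop ℝ) :=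
  negLogTheta_settingPrVolSharpM_le_genuine_of_orbitHull D hlog r M archPk archSub Ψ act Mmod region n lat sig split qData tq htq0 Sq
    htq1 fun i u => thetaLocal_settingMSharp_tOfIdeleData_le_orbitSumM D hlog r tq M archPk archSub Ψ act Mmod region n lat sig split
      qData htq0 Sq htq1 i u

/-- **hΘ for a volume input `I` of `D`** (`IsVolumeInputOf D I`: `I = volumeInputOf D (ideleDataOf D hI)`, abc-iut-w5-d033
`eq_volumeInputOf_ideleDataOf` / `negLogTheta_eq_ideleDataOf`): at the frames-route M-level sharp setting of `I`'s own Θ-ideles,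
`−|log(Θ)| ≤ ↑I.negLogTheta`. [cite: Mochizuki2012, IUTchIII Cor. 3.12 p. 173–174] -/
theorem negLogTheta_settingMSharp_le_of_isVolumeInputOf {I : ThetaVolumeInput (fieldOfModuli E) K}
    (hI : ThetaData.IsVolumeInputOf D I) :
    (settingMSharp D hlog M archPk archSub Ψ act Mmod region n lat sig split qData (tOfIdeleData D (ideleDataOf D hI)) tq htq0
        Sq htq1).negLogTheta ≤ ((I.negLogTheta : ℝ) : WithTop ℝ) := by
  rw [negLogTheta_eq_ideleDataOf D hI]
  exact negLogTheta_settingMSharp_tOfIdeleData_le_genuine D hlog (ideleDataOf D hI) tq M archPk archSub Ψ act Mmod region n lat sig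
    split qData htq0 Sq htq1

end Summit.ABC.IUTFork.Thm311.Real

end
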